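import Summits.AtomisticToContinuum.FouriersLaw.Theses.HonestZwanzig
import Summits.AtomisticToContinuum.FouriersLaw.Theorems.HonestZwanzigFeshbachIdentitiesLaplacePositivity
import Summits.AtomisticToContinuum.FouriersLaw.Theorems.HonestZwanzigFeshbachIdentitiesSiteEnergy
import Summits.AtomisticToContinuum.FouriersLaw.Theorems.BondHeatUncertaintyExtensiveSnapshotIrreversibilityTapDualityOddCorrectorAux1
import Summits.AtomisticToContinuum.FouriersLaw.Theorems.OddSectorIrreversibilityOddDensityIsCorrectorAdjoint
import Summits.AtomisticToContinuum.FouriersLaw.Theorems.HonestZwanzigOrthogonalOhmG0PosDefAux2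

/-!
# HonestZwanzig / OrthogonalOhm — stub F1a `PoissonWeak` (line `Sketch`, skeleton v5)

Support file for crux item `stmt-AtomisticToContinuum-12693` (`HonestZwanzig.OrthogonalOhm`, sub-problem
`FouriersLaw`), line `Sketch`, registered stub `stub_poissonWeak` (F1a of the F-programme `G(0) ≻ 0`).

Setting: the pinned anharmonic chain `P = pinnedChain ω₂ lam β γ` (all parameters `> 0`), `N ≥ 2` sites, both
baths at temperature `T > 0`, Gibbs state `μ = μ_T`, equilibrium semigroup `P_t = transitionKernel N T T t`, the
symmetrically split site energies `e_x`, an energy profile `u = ∑ ξ_x e_x` with mean `m = μ(u)`, and the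
time-integrated fluctuation

  `v(z) = ∫₀^∞ (P_t u(z) − m) dt = ∫₀^∞ P_t(u − m)(z) dt`.

The four conclusions of the stub:

* `|v| ≤ A e^{H/(8T)}` — the Harris bound `|P_t(u − m)(z)| ≤ K C e^{ϑH(z)} e^{−ct}` at `ϑ = 1/(8T)`
  (`pinnedChain_harris_bound`, `μ(u − m) = 0`) integrated in time (`abs_forwardIntegral_le`);
* `v` is (ae strongly) measurable — joint measurability of the forecasts (`stronglyMeasurable_forwardIntegral`);
* `∫₀^∞ corr(u,u)(t) dt = ∫ (u − m) v dμ` — `corr(u,u)(t) = ∫ (u − m) P_t(u − m) dμ` (invariance of `μ`,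
  `pinnedChain_integral_transitionKernel_gibbsMeasure`) and Fubini with the Harris domination (`pairing_fubini`);
* the WEAK POISSON EQUATION in time-reversed form, `∫ (Lφ)(z) v(Θz) dμ = −∫ φ (u − m) dμ` for `φ ∈ C_c^∞`,
  `Θ(q,p) = (q,−p)`: the tree's hypoelliptic Poisson pipeline (`poisson_smooth_of_decay`: `v` agrees Lebesgue-a.e.
  with a smooth `w`, `L w = −(u − m)` pointwise), transported through `Θ` (Lebesgue-measure preserving, `μ ≪ dz`),
  and the generator adjoint identity `∫ (Lφ) k dμ = ∫ φ · (L(k∘Θ))∘Θ dμ`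
  (`pinnedChain_integral_generator_mul_gibbsMeasure_eq_reversal`) with `k = w∘Θ`, plus evenness of `u` in `p`.

* `OrthogonalOhmLine.PoissonWeak.profile_nice` — smoothness / parity / niceness of the profile (smoothness of `e_x` from
  the landed `OrthogonalOhmLine.G0PosDef.contDiff_splitSite`);
* `OrthogonalOhmLine.PoissonWeak.poissonWeak_main` — the four conclusions for an abstract family `e` with its
  defining equation;
* `stub_poissonWeak` — the registered closed signature (gadgets inlined).

References: Cuneo–Eckmann–Hairer–Rey-Bellet, EJP 23 (2018), Thm 2.13; Hörmander, Acta Math. 119 (1967), Thm 1.1;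
Kundu–Dhar–Narayan, J. Stat. Mech. (2009) L03001 (generalised detailed balance). No new definitions.
-/

noncomputable section

open MeasureTheory ProbabilityTheory Filter Topology Set Function
open scoped NNReal ENNReal ContDiff
open Literature.MathematicalPhysics.KineticTheory.HeatConduction
open Literature.MathematicalPhysics.KineticTheory OscillatorChain
open Summit.AtomisticToContinuum.FouriersLaw.Theorems.SubdiffusiveBondHeat
open Summit.AtomisticToContinuum.FouriersLaw.Theorems.OddSectorIrreversibility
open Summit.AtomisticToContinuum.FouriersLaw.Theorems.ExtensiveSnapshotIrreversibility.TapDuality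
open Summit.AtomisticToContinuum.FouriersLaw.Theorems.SuperadditiveResistance.PlainForwardField

namespace Summit.AtomisticToContinuum.FouriersLaw.Theorems.HonestZwanzig

namespace OrthogonalOhmLine.PoissonWeak

variable {N : ℕ}

/-! ### The energy profile -/

section Profile

variable {ω₂ lam β γ : ℝ} (e : Fin N → PhaseSpace N → ℝ)
  (he : ∀ x z, e x z = z.2 x ^ 2 / 2 + (pinnedChain ω₂ lam β γ).U (z.1 x) +
    ∑ j : Fin N, ((if j.val = x.val + 1 then (pinnedChain ω₂ lam β γ).V (z.1 j - z.1 x) / 2 else 0) +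
      (if x.val = j.val + 1 then (pinnedChain ω₂ lam β γ).V (z.1 x - z.1 j) / 2 else 0)))
include he

/-- An energy profile `u = ∑ ξ_x e_x` of the pinned chain (`ω₂ > 0`, `lam, β ≥ 0`) is smooth, even in the momenta,
and nice: `|u| ≤ (∑ |ξ_x| (N+2)/ϑ) e^{ϑH}` for every `ϑ > 0`. [folklore] -/
theorem profile_nice (hω : 0 < ω₂) (hl : 0 ≤ lam) (hβ : 0 ≤ β) (ξ : Fin N → ℝ) :
    ContDiff ℝ ∞ (fun z => ∑ x, ξ x * e x z) ∧
    (∀ z : PhaseSpace N, (∑ x, ξ x * e x (z.1, -z.2)) = ∑ x, ξ x * e x z) ∧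
    ∀ ϑ : ℝ, 0 < ϑ → ∀ z, |∑ x, ξ x * e x z| ≤
      (∑ x, |ξ x| * (((N : ℝ) + 2) / ϑ)) * Real.exp (ϑ * (pinnedChain ω₂ lam β γ).hamiltonian N z) := by
  have hnice := fun x => pinnedChain_splitSite_nice e he hω hl hβ x
  refine ⟨ContDiff.sum fun x _ => contDiff_const.mul (G0PosDef.contDiff_splitSite (e := e) he x), fun z => ?_,
    fun ϑ hϑ z => ?_⟩
  · exact Finset.sum_congr rfl fun x _ => by rw [(hnice x).2.1 z]
  · exact abs_sum_mul_le_exp_bound Finset.univ (fun x y => (hnice x).2.2.2 ϑ hϑ y) ξ z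

end Profile

/-! ### The four conclusions -/

section Main

variable {ω₂ lam β γ : ℝ} (hω : 0 < ω₂) (hl : 0 < lam) (hβ : 0 < β) (hγ : 0 < γ) {T : ℝ} (hT : 0 < T)
  (hN : 0 < N)
include hω hl hβ hγ hT hN

/-- **Stub F1a for an abstract split-site family.** For the pinned chain at equal temperatures `T`, a profile
`u = ∑ ξ_x e_x` with Gibbs mean `m` and `v(z) = ∫₀^∞ (P_t u(z) − m) dt`: `|v| ≤ A e^{H/(8T)}`, `v` is ae strongly
measurable, `∫₀^∞ corr(u,u) = ∫ (u − m) v dμ_T`, and `∫ (Lφ)(z) v(Θz) dμ_T = −∫ φ (u − m) dμ_T` for all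
`φ ∈ C_c^∞`. [cite: CuneoEckmannHairerReyBellet2018, Thm 2.13] -/
theorem poissonWeak_main (e : Fin N → PhaseSpace N → ℝ)
    (he : ∀ x z, e x z = z.2 x ^ 2 / 2 + (pinnedChain ω₂ lam β γ).U (z.1 x) +
      ∑ j : Fin N, ((if j.val = x.val + 1 then (pinnedChain ω₂ lam β γ).V (z.1 j - z.1 x) / 2 else 0) +
        (if x.val = j.val + 1 then (pinnedChain ω₂ lam β γ).V (z.1 x - z.1 j) / 2 else 0)))
    (ξ : Fin N → ℝ) (u : PhaseSpace N → ℝ) (hu : ∀ z, u z = ∑ x, ξ x * e x z) (m : ℝ)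
    (hm : m = ∫ z, u z ∂((pinnedChain ω₂ lam β γ).gibbsMeasure N T)) (v : PhaseSpace N → ℝ)
    (hv : ∀ z, v z = ∫ t in Ioi (0 : ℝ),
      ((∫ y, u y ∂((pinnedChain ω₂ lam β γ).transitionKernel N T T t.toNNReal z)) - m)) :
    (∃ A : ℝ, ∀ z, |v z| ≤ A * Real.exp ((pinnedChain ω₂ lam β γ).hamiltonian N z / (8 * T))) ∧
    AEStronglyMeasurable v ((pinnedChain ω₂ lam β γ).gibbsMeasure N T) ∧
    (∫ t in Ioi (0 : ℝ), ((∫ z, u z * (∫ y, u y ∂((pinnedChain ω₂ lam β γ).transitionKernel N T T t.toNNReal z))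
        ∂((pinnedChain ω₂ lam β γ).gibbsMeasure N T)) -
      (∫ z, u z ∂((pinnedChain ω₂ lam β γ).gibbsMeasure N T)) *
        (∫ z, u z ∂((pinnedChain ω₂ lam β γ).gibbsMeasure N T)))) =
      ∫ z, (u z - m) * v z ∂((pinnedChain ω₂ lam β γ).gibbsMeasure N T) ∧
    (∀ φ : PhaseSpace N → ℝ, ContDiff ℝ ∞ φ → HasCompactSupport φ →
      ∫ z, (pinnedChain ω₂ lam β γ).generator N T T φ z * v (z.1, -z.2)
          ∂((pinnedChain ω₂ lam β γ).gibbsMeasure N T) =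
        -∫ z, φ z * (u z - m) ∂((pinnedChain ω₂ lam β γ).gibbsMeasure N T)) := by
  -- the exponent `ϑ = 1/(8T)`
  obtain ⟨ϑ, hϑ⟩ : ∃ ϑ : ℝ, ϑ = 1 / (8 * T) := ⟨_, rfl⟩
  have hϑ0 : 0 < ϑ := by rw [hϑ]; positivity
  have h2ϑ : 2 * ϑ < 1 / T := by
    rw [hϑ, show (1 : ℝ) / (8 * T) = (1 / T) / 8 by ring]
    have hT' : (0 : ℝ) < 1 / T := by positivity
    linarith
  have hϑ1 : ϑ < 1 / T := by linarith
  have hexp : ∀ z, Real.exp (ϑ * (pinnedChain ω₂ lam β γ).hamiltonian N z) =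
      Real.exp ((pinnedChain ω₂ lam β γ).hamiltonian N z / (8 * T)) := fun z => by
    rw [hϑ]; ring_nf
  set P := pinnedChain ω₂ lam β γ with hP
  set μ := P.gibbsMeasure N T with hμ
  set κ := P.transitionKernel N T T with hκ
  haveI : IsProbabilityMeasure μ := pinnedChain_isProbabilityMeasure_gibbsMeasure hω hl.le hβ.le γ N hT
  haveI : ∀ s, IsMarkovKernel (κ s) := fun s =>
    pinnedChain_isMarkovKernel_transitionKernel hω hl.le hβ.le hγ.le N T T s
  -- the profile `u` and its centring `k = u - m`
  obtain ⟨hus', hueven', hub'⟩ := profile_nice e he hω hl.le hβ.le ξ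
  have hu' : u = fun z => ∑ x, ξ x * e x z := funext hu
  have hus : ContDiff ℝ ∞ u := by rw [hu']; exact hus'
  have huc : Continuous u := hus.continuous
  have hueven : ∀ z : PhaseSpace N, u (z.1, -z.2) = u z := fun z => by rw [hu, hu]; exact hueven' z
  set Cu : ℝ := ∑ x, |ξ x| * (((N : ℝ) + 2) / ϑ) with hCu
  have hCu0 : 0 ≤ Cu := Finset.sum_nonneg fun x _ => by positivity
  have hub : ∀ y, |u y| ≤ Cu * Real.exp (ϑ * P.hamiltonian N y) := fun y => by
    rw [hu]; exact hub' ϑ hϑ0 y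
  set k : PhaseSpace N → ℝ := fun z => u z - m with hk
  have hks : ContDiff ℝ ∞ k := hus.sub contDiff_const
  have hkc : Continuous k := hks.continuous
  have hkb : ∀ y, |k y| ≤ (Cu + |m|) * Real.exp (ϑ * P.hamiltonian N y) := fun y => by
    have h1 := hub y
    have h2 : |m| ≤ |m| * Real.exp (ϑ * P.hamiltonian N y) :=
      le_mul_of_one_le_right (abs_nonneg _) (pinnedChain_one_le_exp_mul_hamiltonian hω hl.le hβ hϑ0.le y)
    calc |u y - m| ≤ |u y| + |m| := abs_sub _ _
      _ ≤ Cu * Real.exp (ϑ * P.hamiltonian N y) + |m| * Real.exp (ϑ * P.hamiltonian N y) := add_le_add h1 h2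
      _ = (Cu + |m|) * Real.exp (ϑ * P.hamiltonian N y) := by ring
  have hC0 : 0 ≤ Cu + |m| := by positivity
  have hkeven : ∀ z : PhaseSpace N, k (z.1, -z.2) = k z := fun z => by simp only [hk, hueven]
  -- `μ_T(k) = 0`
  have hui : Integrable u μ := pinnedChain_integrable_nice hω hl.le hβ hT hϑ1 huc hub
  have hki : Integrable k μ := hui.sub (integrable_const m)
  have hk0 : ∫ z, k z ∂μ = 0 := by
    have h1 : ∫ z, k z ∂μ = (∫ z, u z ∂μ) - ∫ _z, m ∂μ := integral_sub hui (integrable_const m)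
    rw [h1, integral_const, probReal_univ, one_smul, ← hm, sub_self]
  -- exponential decay of the forecasts of `k` (Harris bound)
  obtain ⟨K, c, hK, hc, hb⟩ := pinnedChain_harris_bound hω hl.le hβ hγ hN hT hϑ0 hϑ1
  have hdecay : ∀ (t : ℝ≥0) (z : PhaseSpace N), |∫ y, k y ∂(κ t z)| ≤
      K * (Cu + |m|) * Real.exp (ϑ * P.hamiltonian N z) * Real.exp (-c * t) := by
    intro t z
    have h := hb z t k hkc (Cu + |m|) hC0 hkb
    rwa [hk0, sub_zero] at h
  have hker : ∀ t, P.langevinKernel N T T t = κ t := fun t =>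
    pinnedChain_langevinKernel_eq_transitionKernel N T T hω hl.le hβ.le hγ.le t
  have hkerF : P.langevinKernel N T T = κ := funext hker
  have hdecayL : ∀ (t : ℝ≥0) (z : PhaseSpace N), |∫ y, k y ∂(P.langevinKernel N T T t z)| ≤
      K * (Cu + |m|) * Real.exp (ϑ * P.hamiltonian N z) * Real.exp (-c * t) := fun t z => by
    rw [hker]; exact hdecay t z
  -- `P_t k = P_t u - m`, so `v` is the forward integral of `k`
  have hui' : ∀ (t : ℝ≥0) (z : PhaseSpace N), Integrable u (κ t z) := fun t z =>
    pinnedChain_integrable_transitionKernel_of_abs_le hω hl.le hN hT hβ.le hγ.le hϑ0 hϑ1 huc hub t z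
  have hPk : ∀ (t : ℝ≥0) (z : PhaseSpace N), ∫ y, k y ∂(κ t z) = (∫ y, u y ∂(κ t z)) - m := fun t z => by
    have h1 : ∫ y, k y ∂(κ t z) = (∫ y, u y ∂(κ t z)) - ∫ _y, m ∂(κ t z) :=
      integral_sub (hui' t z) (integrable_const m)
    rw [h1, integral_const, probReal_univ, one_smul]
  set g₀ : PhaseSpace N → ℝ := fun z => ∫ t in Ioi (0 : ℝ), ∫ y, k y ∂(κ t.toNNReal z) with hg₀
  have hvg : v = g₀ := by
    funext z
    rw [hv, hg₀]
    dsimp only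
    congr 1
    funext t
    exact (hPk _ z).symm
  refine ⟨?_, ?_, ?_, ?_⟩
  · -- the admissible bound
    refine ⟨K * (Cu + |m|) * ∫ t in Ioi (0 : ℝ), Real.exp (-c * t), fun z => ?_⟩
    have h := abs_forwardIntegral_le k hc hdecayL z
    rw [hkerF] at h
    rw [hvg, ← hexp z]
    exact h
  · -- measurability
    have h := stronglyMeasurable_forwardIntegral hω hl.le hβ.le hγ.le (N := N) (T := T) hkc
    rw [hkerF] at h
    rw [hvg]
    exact h.aestronglyMeasurable
  · -- the asymptotic variance `∫₀^∞ corr(u,u) = ⟨u - m, v⟩`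
    have hcorr : ∀ t : ℝ, (∫ z, u z * (∫ y, u y ∂(κ t.toNNReal z)) ∂μ) - (∫ z, u z ∂μ) * (∫ z, u z ∂μ) =
        ∫ z, k z * (∫ y, k y ∂(κ t.toNNReal z)) ∂μ := by
      intro t
      rw [pinnedChain_corr_eq_integral_sub hω hl.le hβ hγ hN hT hϑ0 h2ϑ huc huc hub hub t.toNNReal, ← hm]
      have hI1 : Integrable (fun z => u z * ∫ y, k y ∂(κ t.toNNReal z)) μ :=
        pinnedChain_integrable_mul_act_nice hω hl.le hβ hγ hN hT hϑ0 h2ϑ huc hkc hub hkb _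
      have hI2 : Integrable (fun z => ∫ y, k y ∂(κ t.toNNReal z)) μ := by
        have h := pinnedChain_integrable_mul_act_nice hω hl.le hβ hγ hN hT hϑ0 h2ϑ continuous_const hkc
          (f := fun _ => (1 : ℝ)) (Cf := 1)
          (fun y => by rw [abs_one, one_mul]; exact pinnedChain_one_le_exp_mul_hamiltonian hω hl.le hβ hϑ0.le y)
          hkb t.toNNReal
        simpa only [one_mul] using h
      have hinv : ∫ z, (∫ y, k y ∂(κ t.toNNReal z)) ∂μ = 0 := by
        rw [pinnedChain_integral_transitionKernel_gibbsMeasure hω hl.le hβ.le hγ.le hN hT _ hki, hk0]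
      have e1 : (fun z => k z * ∫ y, k y ∂(κ t.toNNReal z)) =
          fun z => u z * (∫ y, k y ∂(κ t.toNNReal z)) - m * ∫ y, k y ∂(κ t.toNNReal z) := by
        funext z; simp only [hk]; ring
      rw [e1, integral_sub hI1 (hI2.const_mul m), integral_const_mul, hinv, mul_zero, sub_zero]
      refine integral_congr_ae (Eventually.of_forall fun z => ?_)
      dsimp only
      rw [hPk]
    obtain ⟨-, hfub⟩ := pairing_fubini hω hl hβ hT hγ.le h2ϑ hc hkc hkc hkb hdecay
    have hZ : ∀ t : ℝ, ∫ z, k z * (∫ y, k y ∂(κ t.toNNReal z)) ∂μ =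
        (∫ x, P.gibbsDensity N T x)⁻¹ * ∫ z, k z * (∫ y, k y ∂(κ t.toNNReal z)) * P.gibbsDensity N T z :=
      fun t => P.integral_gibbsMeasure _
    have hfun : (fun t : ℝ => (∫ z, u z * (∫ y, u y ∂(κ t.toNNReal z)) ∂μ) - (∫ z, u z ∂μ) * (∫ z, u z ∂μ)) =
        fun t : ℝ => (∫ x, P.gibbsDensity N T x)⁻¹ *
          ∫ z, k z * (∫ y, k y ∂(κ t.toNNReal z)) * P.gibbsDensity N T z :=
      funext fun t => by rw [hcorr, hZ]
    rw [hfun, integral_const_mul, hfub, hvg, P.integral_gibbsMeasure]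
  · -- the weak Poisson equation, time-reversed form
    intro φ hφ hφc
    obtain ⟨w, hw, hae, hLw, -⟩ := poisson_smooth_of_decay hω hl hβ hγ hT hN hϑ0 hϑ1 hc hks hkb hdecay
    have hae1 : v =ᵐ[volume] w := by rw [hvg]; exact hae
    have hae2 : (fun z : PhaseSpace N => v (z.1, -z.2)) =ᵐ[volume] fun z : PhaseSpace N => w (z.1, -z.2) := by
      have h := (measurePreserving_momentumReversal N).quasiMeasurePreserving.ae_eq_comp hae1
      simpa only [Function.comp_def, momentumReversal_apply] using h
    have hae3 : (fun z : PhaseSpace N => v (z.1, -z.2)) =ᵐ[μ] fun z : PhaseSpace N => w (z.1, -z.2) :=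
      (P.gibbsMeasure_absolutelyContinuous N T).ae_eq hae2
    have hwr : ContDiff ℝ 2 fun z : PhaseSpace N => w (z.1, -z.2) :=
      (hw.of_le (by norm_cast)).comp (contDiff_fst.prodMk contDiff_snd.neg)
    have hww : (fun y : PhaseSpace N => (fun z : PhaseSpace N => w (z.1, -z.2)) (y.1, -y.2)) = w := by
      funext y; simp only [neg_neg, Prod.mk.eta]
    calc ∫ z, P.generator N T T φ z * v (z.1, -z.2) ∂μ
        = ∫ z, P.generator N T T φ z * w (z.1, -z.2) ∂μ := by
          refine integral_congr_ae ?_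
          filter_upwards [hae3] with z hz
          rw [hz]
      _ = ∫ z, φ z * P.generator N T T
            (fun y : PhaseSpace N => (fun z : PhaseSpace N => w (z.1, -z.2)) (y.1, -y.2)) (z.1, -z.2) ∂μ :=
          pinnedChain_integral_generator_mul_gibbsMeasure_eq_reversal ω₂ lam β γ N hT.ne'
            (hφ.of_le (by norm_cast)) hφc hwr
      _ = ∫ z, φ z * (-k z) ∂μ := by
          refine integral_congr_ae (Eventually.of_forall fun z => ?_)
          dsimp only
          rw [hww, hLw, hkeven]
      _ = -∫ z, φ z * (u z - m) ∂μ := by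
          rw [← integral_neg]
          exact integral_congr_ae (Eventually.of_forall fun z => by simp only [hk]; ring)

end Main

end OrthogonalOhmLine.PoissonWeak

open OrthogonalOhmLine.PoissonWeak in
/-- **Stub F1a** (`PoissonWeak`, fixed `N`, line `Sketch` of crux `stmt-AtomisticToContinuum-12693`): for every
profile `ξ`, the time-integrated fluctuation `v = ∫₀^∞ (P_t u − m) dt` of `u = Σ ξ_x e_x` is admissibly bounded and
measurable, carries the asymptotic variance (`∫₀^∞ corr(u,u) = ∫ (u − m) v dμ`), and solves the Poisson equation
weakly in the time-reversed form `∫ (Lφ) · (v∘Θ) dμ = −∫ φ (u − m) dμ` for all test functions `φ`.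
[cite: CuneoEckmannHairerReyBellet2018, Thm 2.13] -/
theorem stub_poissonWeak :
    ∀ ω₂ lam β γ : ℝ, 0 < ω₂ → 0 < lam → 0 < β → 0 < γ → ∀ T : ℝ, 0 < T → ∀ N : ℕ, 2 ≤ N → ∀ ξ : Fin N → ℝ, let P := Literature.MathematicalPhysics.KineticTheory.HeatConduction.pinnedChain ω₂ lam β γ; let X := Literature.MathematicalPhysics.KineticTheory.HeatConduction.PhaseSpace N; let μ : MeasureTheory.Measure X := P.gibbsMeasure N T; let e : Fin N → X → ℝ := fun x z => z.2 x ^ 2 / 2 + P.U (z.1 x) + ∑ j : Fin N, ((if j.val = x.val + 1 then P.V (z.1 j - z.1 x) / 2 else 0) + (if x.val = j.val + 1 then P.V (z.1 x - z.1 j) / 2 else 0)); let u : X → ℝ := fun z => ∑ x : Fin N, ξ x * e x z; let m : ℝ := ∫ z, u z ∂μ; let v : X → ℝ := fun z => ∫ t in Set.Ioi (0 : ℝ), ((∫ y, u y ∂(P.transitionKernel N T T t.toNNReal z)) - m);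
      (∃ A : ℝ, ∀ z, |v z| ≤ A * Real.exp (P.hamiltonian N z / (8 * T))) ∧
      MeasureTheory.AEStronglyMeasurable v μ ∧
      (∫ t in Set.Ioi (0 : ℝ), ((∫ z, u z * (∫ y, u y ∂(P.transitionKernel N T T t.toNNReal z)) ∂μ) -
          (∫ z, u z ∂μ) * (∫ z, u z ∂μ))) = ∫ z, (u z - m) * v z ∂μ ∧
      (∀ φ : X → ℝ, ContDiff ℝ ∞ φ → HasCompactSupport φ →
        ∫ z, P.generator N T T φ z * v (z.1, -z.2) ∂μ = -∫ z, φ z * (u z - m) ∂μ) := by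
  intro ω₂ lam β γ hω hl hβ hγ T hT N hN ξ P X μ e u m v
  exact poissonWeak_main hω hl hβ hγ hT (by omega) e (fun x z => rfl) ξ u (fun z => rfl) m rfl v (fun z => rfl)

end Summit.AtomisticToContinuum.FouriersLaw.Theorems.HonestZwanzig

end
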